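import Summits.MatrixMultiplication.MatrixMultiplication.Theorems.SoloInformedBigCentroidFamily
import Literature.Barriers.MatrixMultiplication.IrreversibilityBarrierAssembly
import HarnessLib

/-!
# The big centroid family `T_{p,q,r}` (Kassabov–Landsberg–Souza–Speegle 2026), II: every member is irreversible

Solo programme `solo-MatrixMultiplication-informed` (gen 58), claim c463, part 2 of 2 (part 1:
`SoloInformedBigCentroidFamily` — the tensor `bigcen K p q r`, `ζ⁽¹⁾(T_{p,q,r}) = qr + p`, and
the cross-entropy certificate `Q̃(T_{p,q,r}) ≤ E_d^{1/3}`, `E_d = (p²+d)(q²+d)(r²+d)/d`).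

**This file** (any field `K`; `p, q, r ≥ 1`, `qr ≥ 2`):
* `two_irreversibility_bigcen_ge` — `2 i(T_{p,q,r}) ≥ 6 log₂(qr+p) / log₂ E_d` for every `d > 0`;
* `bigcen_ne_triad` — `T_{p,q,r}` is not a triad (CVZ Assumption 1);
* `irreversibilityBarrier_bigcenFamily` — by CVZ Thm. 9, for every `d > 0`,
  `ω(⟨2⟩, T) · ω(T, ⟨2,2,2⟩) ≥ 6 log₂(qr+p) / log₂((p²+d)(q²+d)(r²+d)/d)`;
* `irreversibilityBarrier_bigcenFamily_gt_two` — with `d = qr/2` the value is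
  `6 log₂(qr+p) / log₂((2p²+qr)(2q+r)(2r+q)/4)`, and `(2p²+qr)(2q+r)(2r+q) < 4(qr+p)³` whenever
  `1 ≤ p ≤ q`, `p ≤ r` (`famD_lt`: after `p = 1+u`, `q = p+s`, `r = p+t` the difference is a
  polynomial in `u, s, t` with nonnegative integer coefficients and constant term `5`), so the
  certified bound through ANY `T_{p,q,r}` with `p = min(p,q,r)` (which one may assume after
  permuting the roles of `a, b, c`) and `qr ≥ 2` is `> 2`. Values: `2.2004` (`T_{1,1,2}`),
  `2.2961` (`T_{2,2,2}`), `2.3638` (`T_{2,2,3}`), `2.4208` (`T_{1,2,2}`), `2.4745` (`T_{1,2,3}`).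
  The excluded shape `(1,1,1)` is the W-state (`irreversibilityBarrier_cw`);
* `famE_balanced`, `famE_corner` — the certificates of the two earlier files are the members
  `d = n²/2` (`E = 27n⁴/4`) and `d = 1` (`E = 4(r²+1)`).

**Verdict for the dossier.** No big centroid tensor, of any shape, can carry a proof of `ω = 2`
by a method of the CVZ class (laser method on arbitrary Kronecker powers, any degeneration of
powers of `T_{p,q,r}` to matrix multiplication): the whole family is irreversible, i.e. falls
under constraint C2 — Kronecker powers included (KLSS §8: "future work") — and moves none of the
doors D1–D12 of `EXECUTIVE.md` §3.

References: [cite: KassabovEtAl2026, Ex. 2.2, Rem. 5.4, Table 1, §8] (arXiv:2608.27434);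
[cite: ChristandlVranaZuiddam2021, Def. 4, Thm. 9, Prop. 17, §3.1, §4.2].
-/

open scoped BigOperators

namespace Summit.MatrixMultiplication.MatrixMultiplication.Theorems

open Literature.Computability.AlgebraicComplexity Literature.Barriers.MatrixMultiplication

namespace BigCentroidFamily

variable {K : Type} [Field K] {p q r : ℕ} {d : ℝ}


/-! ## Irreversibility and the barrier -/

/-- **`2 i(T_{p,q,r}) ≥ 6 log₂(qr+p) / log₂ E_d`** for every `d > 0` (`p, q, r ≥ 1`, `qr ≥ 2`).
[cite: ChristandlVranaZuiddam2021, Def. 4 and Prop. 17] -/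
theorem two_irreversibility_bigcen_ge (hp : 1 ≤ p) (hq : 1 ≤ q) (hr : 1 ≤ r) (h2 : 2 ≤ q * r)
    (hd : 0 < d) :
    6 * Real.logb 2 ((q : ℝ) * r + p) / Real.logb 2 (famE p q r d) ≤
      2 * irreversibility (bigcen K p q r) := by
  have hc := logb_famE_pos hp hq hr hd
  have hA := logb_le_relativeExponent_unit_bigcen (K := K) (p := p) (q := q) hr
  have hB := three_div_le_relativeExponent_bigcen_unit (K := K) hp hq hr h2 hd
  have hp1 : (1 : ℝ) ≤ p := by exact_mod_cast hp
  have hq0 : (0 : ℝ) ≤ q := by exact_mod_cast (Nat.zero_le q)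
  have hr0 : (0 : ℝ) ≤ r := by exact_mod_cast (Nat.zero_le r)
  have hlog0 : 0 ≤ Real.logb 2 ((q : ℝ) * r + p) :=
    Real.logb_nonneg one_lt_two (by nlinarith [mul_nonneg hq0 hr0])
  have hprod : Real.logb 2 ((q : ℝ) * r + p) * (3 / Real.logb 2 (famE p q r d))
      ≤ irreversibility (bigcen K p q r) := by
    unfold irreversibility
    exact mul_le_mul hA hB (by positivity) (relativeExponent_nonneg _ _)
  calc 6 * Real.logb 2 ((q : ℝ) * r + p) / Real.logb 2 (famE p q r d)
      = 2 * (Real.logb 2 ((q : ℝ) * r + p) * (3 / Real.logb 2 (famE p q r d))) := by ring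
    _ ≤ 2 * irreversibility (bigcen K p q r) := by linarith

/-- `T_{p,q,r}` is not a triad `w ⊗ u ⊗ v` (CVZ Assumption 1; `p, q, r ≥ 1`): the entries at
`(a_{00}, b_0, c_0)`, `(a_0, b_{00}, c_0)`, `(a_{00}, b_{00}, c_0)` are `1, 1, 0`. [folklore] -/
theorem bigcen_ne_triad (hp : 1 ≤ p) (hq : 1 ≤ q) (hr : 1 ≤ r) (w : IdxA p q r → K)
    (u : IdxB p q r → K) (v : IdxC p q r → K) : bigcen K p q r ≠ triad w u v := by
  intro h
  set i : Fin p := ⟨0, hp⟩ with hi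
  set j : Fin q := ⟨0, hq⟩ with hj
  set k : Fin r := ⟨0, hr⟩ with hk
  have h1 := congrFun (congrFun (congrFun h (Sum.inl (j, k))) (Sum.inr j)) (Sum.inr k)
  have h2 := congrFun (congrFun (congrFun h (Sum.inr i)) (Sum.inl (i, k))) (Sum.inr k)
  have h3 := congrFun (congrFun (congrFun h (Sum.inl (j, k))) (Sum.inl (i, k))) (Sum.inr k)
  simp only [bigcen_lrr, bigcen_rlr, bigcen_ll, triad_apply, if_true] at h1 h2 h3
  rcases mul_eq_zero.1 h3.symm with hwu | hv
  · rcases mul_eq_zero.1 hwu with hw | hu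
    · rw [hw] at h1; simp at h1
    · rw [hu] at h2; simp at h2
  · rw [hv] at h1; simp at h1

/-- **The irreversibility barrier for the big centroid family** (any field; `p, q, r ≥ 1`,
`qr ≥ 2`; every `d > 0`): every upper bound on `ω` certified through the fixed intermediate tensor
`T_{p,q,r}` is at least `6 log₂(qr+p) / log₂((p²+d)(q²+d)(r²+d)/d)`.
[cite: ChristandlVranaZuiddam2021, Thm. 9] [cite: KassabovEtAl2026, Ex. 2.2 and §8] -/
theorem irreversibilityBarrier_bigcenFamily (K : Type) [Field K] (hp : 1 ≤ p) (hq : 1 ≤ q)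
    (hr : 1 ≤ r) (h2 : 2 ≤ q * r) (hd : 0 < d) :
    6 * Real.logb 2 ((q : ℝ) * r + p) / Real.logb 2 (famE p q r d) ≤
      relativeExponent (unitTensor K 2) (bigcen K p q r) *
        relativeExponent (bigcen K p q r) (matMulTensor K 2 2 2) :=
  (two_irreversibility_bigcen_ge hp hq hr h2 hd).trans
    (IrreversibilityBarrier_holds.thm9 K (bigcen K p q r) (bigcen_ne_triad hp hq hr))

/-! ## The value exceeds `2` at `d = qr/2` when `p = min(p, q, r)` -/

/-- `D(p,q,r) = (2p²+qr)(2q+r)(2r+q)`, four times `E_{qr/2}`. [folklore] -/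
noncomputable def famD (p q r : ℕ) : ℝ := (2 * (p : ℝ) ^ 2 + q * r) * (2 * q + r) * (2 * r + q)

/-- `E_{qr/2} = D/4` (`q, r ≥ 1`). [folklore] -/
theorem famE_half (hq : 1 ≤ q) (hr : 1 ≤ r) :
    famE p q r ((q : ℝ) * r / 2) = famD p q r / 4 := by
  have hq0 : (q : ℝ) ≠ 0 := by exact_mod_cast (show q ≠ 0 by omega)
  have hr0 : (r : ℝ) ≠ 0 := by exact_mod_cast (show r ≠ 0 by omega)
  unfold famE famD
  field_simp
  ring

/-- **`D < 4 (qr+p)³` whenever `1 ≤ p ≤ q` and `p ≤ r`**: writing `p = 1+u`, `q = p+s`, `r = p+t`,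
the difference `4(qr+p)³ − D` is a polynomial in `u, s, t ≥ 0` with nonnegative integer
coefficients and constant term `5`. [folklore] -/
theorem famD_lt (hp : 1 ≤ p) (hpq : p ≤ q) (hpr : p ≤ r) :
    famD p q r < 4 * ((q : ℝ) * r + p) ^ 3 := by
  obtain ⟨u, rfl⟩ := Nat.exists_eq_add_of_le hp
  obtain ⟨s, rfl⟩ := Nat.exists_eq_add_of_le hpq
  obtain ⟨t, rfl⟩ := Nat.exists_eq_add_of_le hpr
  unfold famD
  push_cast
  have hu : (0 : ℝ) ≤ u := Nat.cast_nonneg u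
  have hs : (0 : ℝ) ≤ s := Nat.cast_nonneg s
  have ht : (0 : ℝ) ≤ t := Nat.cast_nonneg t
  have key : 4 * (((1 : ℝ) + u + s) * (1 + u + t) + (1 + u)) ^ 3 -
      (2 * ((1 : ℝ) + u) ^ 2 + (1 + u + s) * (1 + u + t)) * (2 * (1 + u + s) + (1 + u + t)) *
        (2 * (1 + u + t) + (1 + u + s)) =
      5 + 12 * t + 9 * t ^ 2 + 2 * t ^ 3 + 12 * s + 54 * s * t + 44 * s * t ^ 2 + 10 * s * t ^ 3
      + 9 * s ^ 2 + 44 * s ^ 2 * t + 43 * s ^ 2 * t ^ 2 + 12 * s ^ 2 * t ^ 3 + 2 * s ^ 3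
      + 10 * s ^ 3 * t + 12 * s ^ 3 * t ^ 2 + 4 * s ^ 3 * t ^ 3 + 36 * u + 84 * u * t
      + 54 * u * t ^ 2 + 10 * u * t ^ 3 + 84 * u * s + 228 * u * s * t + 140 * u * s * t ^ 2
      + 24 * u * s * t ^ 3 + 54 * u * s ^ 2 + 140 * u * s ^ 2 * t + 84 * u * s ^ 2 * t ^ 2
      + 12 * u * s ^ 2 * t ^ 3 + 10 * u * s ^ 3 + 24 * u * s ^ 3 * t + 12 * u * s ^ 3 * t ^ 2
      + 102 * u ^ 2 + 192 * u ^ 2 * t + 93 * u ^ 2 * t ^ 2 + 12 * u ^ 2 * t ^ 3 + 192 * u ^ 2 * s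
      + 330 * u ^ 2 * s * t + 132 * u ^ 2 * s * t ^ 2 + 12 * u ^ 2 * s * t ^ 3 + 93 * u ^ 2 * s ^ 2
      + 132 * u ^ 2 * s ^ 2 * t + 36 * u ^ 2 * s ^ 2 * t ^ 2 + 12 * u ^ 2 * s ^ 3
      + 12 * u ^ 2 * s ^ 3 * t + 144 * u ^ 3 + 192 * u ^ 3 * t + 60 * u ^ 3 * t ^ 2
      + 4 * u ^ 3 * t ^ 3 + 192 * u ^ 3 * s + 192 * u ^ 3 * s * t + 36 * u ^ 3 * s * t ^ 2
      + 60 * u ^ 3 * s ^ 2 + 36 * u ^ 3 * s ^ 2 * t + 4 * u ^ 3 * s ^ 3 + 105 * u ^ 4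
      + 84 * u ^ 4 * t + 12 * u ^ 4 * t ^ 2 + 84 * u ^ 4 * s + 36 * u ^ 4 * s * t
      + 12 * u ^ 4 * s ^ 2 + 36 * u ^ 5 + 12 * u ^ 5 * t + 12 * u ^ 5 * s + 4 * u ^ 6 := by
    ring
  have pos : (0 : ℝ) < 5 + 12 * t + 9 * t ^ 2 + 2 * t ^ 3 + 12 * s + 54 * s * t + 44 * s * t ^ 2
      + 10 * s * t ^ 3
      + 9 * s ^ 2 + 44 * s ^ 2 * t + 43 * s ^ 2 * t ^ 2 + 12 * s ^ 2 * t ^ 3 + 2 * s ^ 3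
      + 10 * s ^ 3 * t + 12 * s ^ 3 * t ^ 2 + 4 * s ^ 3 * t ^ 3 + 36 * u + 84 * u * t
      + 54 * u * t ^ 2 + 10 * u * t ^ 3 + 84 * u * s + 228 * u * s * t + 140 * u * s * t ^ 2
      + 24 * u * s * t ^ 3 + 54 * u * s ^ 2 + 140 * u * s ^ 2 * t + 84 * u * s ^ 2 * t ^ 2
      + 12 * u * s ^ 2 * t ^ 3 + 10 * u * s ^ 3 + 24 * u * s ^ 3 * t + 12 * u * s ^ 3 * t ^ 2
      + 102 * u ^ 2 + 192 * u ^ 2 * t + 93 * u ^ 2 * t ^ 2 + 12 * u ^ 2 * t ^ 3 + 192 * u ^ 2 * s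
      + 330 * u ^ 2 * s * t + 132 * u ^ 2 * s * t ^ 2 + 12 * u ^ 2 * s * t ^ 3 + 93 * u ^ 2 * s ^ 2
      + 132 * u ^ 2 * s ^ 2 * t + 36 * u ^ 2 * s ^ 2 * t ^ 2 + 12 * u ^ 2 * s ^ 3
      + 12 * u ^ 2 * s ^ 3 * t + 144 * u ^ 3 + 192 * u ^ 3 * t + 60 * u ^ 3 * t ^ 2
      + 4 * u ^ 3 * t ^ 3 + 192 * u ^ 3 * s + 192 * u ^ 3 * s * t + 36 * u ^ 3 * s * t ^ 2
      + 60 * u ^ 3 * s ^ 2 + 36 * u ^ 3 * s ^ 2 * t + 4 * u ^ 3 * s ^ 3 + 105 * u ^ 4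
      + 84 * u ^ 4 * t + 12 * u ^ 4 * t ^ 2 + 84 * u ^ 4 * s + 36 * u ^ 4 * s * t
      + 12 * u ^ 4 * s ^ 2 + 36 * u ^ 5 + 12 * u ^ 5 * t + 12 * u ^ 5 * s + 4 * u ^ 6 := by
    positivity
  linarith

/-- `D ≥ 27 > 4` (`p, q, r ≥ 1`), so `log₂(D/4) > 0`. [folklore] -/
theorem logb_famD_div_four_pos (hp : 1 ≤ p) (hq : 1 ≤ q) (hr : 1 ≤ r) :
    0 < Real.logb 2 (famD p q r / 4) := by
  have h := logb_famE_pos hp hq hr (d := (q : ℝ) * r / 2)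
    (by have hq1 : (1 : ℝ) ≤ q := by exact_mod_cast hq
        have hr1 : (1 : ℝ) ≤ r := by exact_mod_cast hr
        have : (1 : ℝ) ≤ (q : ℝ) * r := by nlinarith
        linarith)
  rwa [famE_half hq hr] at h

/-- **The barrier value at `d = qr/2` exceeds `2`** when `1 ≤ p ≤ q`, `p ≤ r`:
`2 < 6 log₂(qr+p) / log₂(D/4)` since `D/4 < (qr+p)³`. [folklore] -/
theorem two_lt_bigcenFamilyBarrierValue (hp : 1 ≤ p) (hpq : p ≤ q) (hpr : p ≤ r) :
    2 < 6 * Real.logb 2 ((q : ℝ) * r + p) / Real.logb 2 (famD p q r / 4) := by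
  have hq : 1 ≤ q := hp.trans hpq
  have hr : 1 ≤ r := hp.trans hpr
  have hc := logb_famD_div_four_pos hp hq hr
  have hp1 : (1 : ℝ) ≤ p := by exact_mod_cast hp
  have hq0 : (0 : ℝ) ≤ q := by exact_mod_cast (Nat.zero_le q)
  have hr0 : (0 : ℝ) ≤ r := by exact_mod_cast (Nat.zero_le r)
  have hm : (0 : ℝ) < (q : ℝ) * r + p := by nlinarith [mul_nonneg hq0 hr0]
  rw [lt_div_iff₀ hc]
  have key : famD p q r / 4 < ((q : ℝ) * r + p) ^ 3 := by
    have := famD_lt hp hpq hpr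
    linarith
  have hD : 0 < famD p q r / 4 := by
    have h27 : (0 : ℝ) < famD p q r := by
      unfold famD; positivity
    positivity
  have hlog := Real.logb_lt_logb one_lt_two hD key
  rw [Real.logb_pow] at hlog
  push_cast at hlog
  linarith

/-- **No big centroid tensor can prove `ω = 2`**: through `T_{p,q,r}` (any field; `1 ≤ p ≤ q`,
`p ≤ r`, `qr ≥ 2` — i.e. every shape except the W-state `(1,1,1)`, after permuting the roles of
`a, b, c` so that `p = min`) the certified bound `ω(⟨2⟩, T) · ω(T, ⟨2,2,2⟩)` is `> 2`.
[cite: ChristandlVranaZuiddam2021, §3.1] [cite: KassabovEtAl2026, Ex. 2.2 and §8] -/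
theorem irreversibilityBarrier_bigcenFamily_gt_two (K : Type) [Field K] (hp : 1 ≤ p) (hpq : p ≤ q)
    (hpr : p ≤ r) (h2 : 2 ≤ q * r) :
    2 < relativeExponent (unitTensor K 2) (bigcen K p q r) *
      relativeExponent (bigcen K p q r) (matMulTensor K 2 2 2) := by
  have hq : 1 ≤ q := hp.trans hpq
  have hr : 1 ≤ r := hp.trans hpr
  have hq1 : (1 : ℝ) ≤ q := by exact_mod_cast hq
  have hr1 : (1 : ℝ) ≤ r := by exact_mod_cast hr
  have hd : (0 : ℝ) < (q : ℝ) * r / 2 := by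
    have : (1 : ℝ) ≤ (q : ℝ) * r := by nlinarith
    linarith
  have h := irreversibilityBarrier_bigcenFamily K hp hq hr h2 hd
  rw [famE_half hq hr] at h
  exact (two_lt_bigcenFamilyBarrierValue hp hpq hpr).trans_le h

/-- The balanced certificate of `SoloInformedBigCentroidBarrier` is the member `d = n²/2`:
`E_{n²/2}(n,n,n) = 27 n⁴ / 4` (`n ≥ 1`). [cite: KassabovEtAl2026, Rem. 5.4] -/
theorem famE_balanced {n : ℕ} (hn : 1 ≤ n) :
    famE n n n ((n : ℝ) ^ 2 / 2) = 27 * (n : ℝ) ^ 4 / 4 := by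
  have hn0 : (n : ℝ) ≠ 0 := by exact_mod_cast (show n ≠ 0 by omega)
  unfold famE
  field_simp
  ring

/-- The corner certificate of `SoloInformedBigCentroidCorners` is the member `d = 1`:
`E_1(1,1,r) = 4 (r² + 1)`. [cite: KassabovEtAl2026, Table 1] -/
theorem famE_corner (r : ℕ) : famE 1 1 r 1 = 4 * ((r : ℝ) ^ 2 + 1) := by
  unfold famE
  push_cast
  ring


end BigCentroidFamily

end Summit.MatrixMultiplication.MatrixMultiplication.Theorems
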